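import Summits.ABC.StewartYu.PadicG3TwoSizesAux
import Summits.ABC.StewartYu.PadicG3TwoScheduleEnd
import Literature.NumberTheory.Transcendental.PiTranscendenceMeasureMain
import HarnessLib

/-!
# Cell abc-stewartyu, Gen-3 frame at `p = 2` (crux `Y07Two`, stmt-ABC-19659), record interface: LEVEL-UNIFORM bounds
# of the node ranges, the Fel'dman argument and the far-height line of the schedule of record `schedTwoS`

`Summits/ABC/StewartYu/PadicG3TwoSizesUnif.lean` — cell `abc-stewartyu` (HOME `run/shared/lean/pub/abc-stewartyu/`),
route `PadicPrimesKummerThird`, seat p5 (g3); sequel to `PadicG3TwoSizesAux` / `PadicG3TwoScheduleEnd`.  Theorems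
only.  Nesterenko's invariant «zeros × multiplicity and heights × range are LEVEL-INDEPENDENT» in the tree's letters:
* `Xs3_real_le` : `Xs3 I ≤ 3^I·X`;  `Nsub3_real_le` : `Nsub3 I k ≤ 3^{I+k+1}·X`;
* `feld_arg_le` : for `I ≤ I*` and `|x₁| ≤ Nsub3 I k`, `3^{I*−I}·|x₁| ≤ 3^{I*+k+1}·X` (the argument of the
  pre-scaled Fel'dman polynomials is the same at every level);
* `far_height_le` : for `|x₁| ≤ Nsub3 I k` and heights `h(αⱼ) ≤ Aⱼ`, `h(θ) ≤ A_θ`,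
  `4|x₁|·hboxR I ≤ 8·3^{k+1}·X·((d+1)·L/2 + ∑ⱼAⱼ + A_θ)` (the far-height line does not grow with the level);
* `log_feldSize_le_unif` : `log feldSize I |x₁| t ≤ (I*−I)·t·log 3 + t·(23/20)·H + H/e +
  L₀·(1 + log(1 + 3^{I*+k+1}·X/H))` under the same range hypothesis (`log ν(H) ≤ (23/20)H` from lit).

WHAT THIS IS NOT: budget comparisons; no crux moves.

References: Yu. V. Nesterenko, LNM 1819 (2003), §4.3 (4.35), (4.45); K. Yu, Acta Math. 211 (2013), (5.23)–(5.24).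
-/

noncomputable section

open Finset Real
open Literature.NumberTheory.Transcendental

namespace Summit.ABC.StewartYu

namespace TwoSetup

variable (S : TwoSetup) (P : PadicG3Par (S.d + 1))

/-! ### Ranges -/

/-- **`Xs3 I ≤ 3^I·X`** (`Xs3 I = ⌊4XL/(⌊4L/3^I⌋+1)⌋` and `⌊4L/3^I⌋ + 1 > 4L/3^I`). [cite: Nesterenko2003, (4.3); shape only] -/
theorem Xs3_real_le (I : ℕ) : (S.Xs3 P I : ℝ) ≤ (3 : ℝ) ^ I * P.X := by
  unfold Xs3 T3
  have h3 : (0 : ℝ) < (3 : ℝ) ^ I := by positivity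
  -- `T3 I + 1 > 4L/3^I` as reals
  have hT : (4 * (P.L : ℝ)) / 3 ^ I < ((4 * P.L / 3 ^ I + 1 : ℕ) : ℝ) := by
    have h := Nat.lt_div_mul_add (a := 4 * P.L) (b := 3 ^ I) (by positivity)
    have h' : ((4 * P.L : ℕ) : ℝ) < ((4 * P.L / 3 ^ I + 1 : ℕ) : ℝ) * (3 : ℝ) ^ I := by
      have := (Nat.cast_lt (α := ℝ)).mpr h
      push_cast at this ⊢
      linarith
    rw [div_lt_iff₀ h3]
    push_cast at h' ⊢
    linarith
  have hden : (0 : ℝ) < ((4 * P.L / 3 ^ I + 1 : ℕ) : ℝ) := by positivity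
  have hdiv := Nat.cast_div_le (α := ℝ) (m := 4 * P.X * P.L) (n := 4 * P.L / 3 ^ I + 1)
  refine hdiv.trans ?_
  rw [div_le_iff₀ hden]
  rcases Nat.eq_zero_or_pos P.L with hL | hL
  · simp [hL]
  · have hX : (0 : ℝ) ≤ P.X := by positivity
    have hLr : (0 : ℝ) < P.L := by exact_mod_cast hL
    -- `4XL = X·(4L) ≤ X·3^I·(T+1)`
    have key : (4 * (P.L : ℝ)) ≤ (3 : ℝ) ^ I * ((4 * P.L / 3 ^ I + 1 : ℕ) : ℝ) := by
      rw [div_lt_iff₀ h3] at hT; linarith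
    push_cast at key ⊢
    nlinarith [key, hX]

/-- **`Nsub3 I k ≤ 3^{I+k+1}·X`.** [cite: Yu2013, (5.23); shape only] -/
theorem Nsub3_real_le (I k : ℕ) : (S.Nsub3 P I k : ℝ) ≤ (3 : ℝ) ^ (I + k + 1) * P.X := by
  have hXs := S.Xs3_real_le P I
  have hX : (0 : ℝ) ≤ P.X := by positivity
  have hXs0 : (0 : ℝ) ≤ (S.Xs3 P I : ℝ) := by positivity
  have h3I : (1 : ℝ) ≤ (3 : ℝ) ^ I := one_le_pow₀ (by norm_num)
  have h3k : (1 : ℝ) ≤ (3 : ℝ) ^ k := one_le_pow₀ (by norm_num)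
  have epow : (3 : ℝ) ^ (I + k + 1) = (3 : ℝ) ^ I * (3 : ℝ) ^ k * 3 := by rw [pow_succ, pow_add]
  rw [epow]
  unfold Nsub3
  split_ifs with hk hI
  · nlinarith [mul_le_mul h3I h3k zero_le_one (le_trans zero_le_one h3I)]
  · push_cast
    nlinarith [mul_le_mul_of_nonneg_left h3k (le_trans zero_le_one h3I), hXs]
  · push_cast
    have h1 : (3 : ℝ) ^ k * (S.Xs3 P I : ℝ) ≤ (3 : ℝ) ^ k * ((3 : ℝ) ^ I * P.X) :=
      mul_le_mul_of_nonneg_left hXs (by positivity)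
    nlinarith [h1]

/-- **The Fel'dman argument is level-independent**: `3^{I*−I}·|x₁| ≤ 3^{I*+k+1}·X` for `I ≤ I*`,
`|x₁| ≤ Nsub3 I k`. [cite: Nesterenko2003, (4.45); shape only] -/
theorem feld_arg_le {I k : ℕ} (hI : I ≤ S.Istar3 P) {x₁ : ℤ} (hx : |x₁| ≤ (S.Nsub3 P I k : ℤ)) :
    (3 : ℝ) ^ (S.Istar3 P - I) * |(x₁ : ℝ)| ≤ (3 : ℝ) ^ (S.Istar3 P + k + 1) * P.X := by
  have hx' : |(x₁ : ℝ)| ≤ (S.Nsub3 P I k : ℝ) := by exact_mod_cast hx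
  have hN := S.Nsub3_real_le P I k
  have e : (3 : ℝ) ^ (S.Istar3 P + k + 1) = (3 : ℝ) ^ (S.Istar3 P - I) * (3 : ℝ) ^ (I + k + 1) := by
    rw [← pow_add]; congr 1; omega
  rw [e, mul_assoc]
  exact mul_le_mul_of_nonneg_left (hx'.trans hN) (by positivity)

/-- **The far-height line is level-independent**: `4|x₁|·hboxR I ≤ 8·3^{k+1}·X·((d+1)L/2 + ∑ⱼAⱼ + A_θ)`.
[cite: Nesterenko2003, §4.3 (4.35); shape only] -/
theorem far_height_le {I k : ℕ} {x₁ : ℤ} (hx : |x₁| ≤ (S.Nsub3 P I k : ℤ))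
    (hVα : ∀ j, Height.logHeight₁ (S.α j) ≤ P.A (Fin.castSucc j))
    (hVθ : Height.logHeight₁ S.θ ≤ P.A (Fin.last S.d)) :
    4 * |(x₁ : ℝ)| * S.hboxR P I ≤
      8 * (3 : ℝ) ^ (k + 1) * P.X * ((S.d + 1) * (P.L : ℝ) / 2 + ∑ j, P.A (Fin.castSucc j) + P.A (Fin.last S.d)) := by
  have hx' : |(x₁ : ℝ)| ≤ (S.Nsub3 P I k : ℝ) := by exact_mod_cast hx
  have hN := S.Nsub3_real_le P I k
  have hh := S.hboxR_le_of_heights P I hVα hVθ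
  have hh0 := S.hboxR_nonneg P I
  set Sg : ℝ := (S.d + 1) * (P.L : ℝ) / 2 + ∑ j, P.A (Fin.castSucc j) + P.A (Fin.last S.d) with hSg
  have hSg0 : 0 ≤ Sg := by
    have hA : 0 ≤ ∑ j, P.A (Fin.castSucc j) := Finset.sum_nonneg fun j _ => (S.A_pos P _).le
    have hθ := (S.A_pos P (Fin.last S.d)).le
    have hL : (0 : ℝ) ≤ (S.d + 1) * (P.L : ℝ) / 2 := by positivity
    rw [hSg]; linarith
  have h1 : 4 * |(x₁ : ℝ)| * S.hboxR P I ≤ 4 * ((3 : ℝ) ^ (I + k + 1) * P.X) * (2 / 3 ^ I * Sg) := by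
    have ha : 4 * |(x₁ : ℝ)| ≤ 4 * ((3 : ℝ) ^ (I + k + 1) * P.X) := by linarith [hx'.trans hN]
    exact mul_le_mul ha hh hh0 (by positivity)
  refine h1.trans (le_of_eq ?_)
  have h3 : (3 : ℝ) ^ I ≠ 0 := by positivity
  rw [show I + k + 1 = I + (k + 1) by ring, pow_add]
  field_simp
  ring

/-- **The Hasse size, level-uniform**: for `I ≤ I*`, `|x₁| ≤ Nsub3 I k`,
`log feldSize I |x₁| t ≤ (I*−I)·t·log 3 + t·(23/20)·H + H/e + L₀·(1 + log(1 + 3^{I*+k+1}·X/H))`.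
[cite: Nesterenko2003, §3.1 Prop 3.1; shape only] -/
theorem log_feldSize_le_unif {I k : ℕ} (hI : I ≤ S.Istar3 P) {x₁ : ℤ} (hx : |x₁| ≤ (S.Nsub3 P I k : ℤ))
    (t : ℕ) :
    Real.log (S.feldSize P I |(x₁ : ℝ)| t) ≤ ((S.Istar3 P - I) * t : ℕ) * Real.log 3 + t * (23 / 20 * (P.H : ℝ)) +
      P.H / Real.exp 1 + P.L₀ * (1 + Real.log (1 + (3 : ℝ) ^ (S.Istar3 P + k + 1) * P.X / P.H)) := by
  rw [S.log_feldSize P I (abs_nonneg _) t]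
  have hH1' : 1 ≤ P.H := le_max_left _ _
  have hH1 : (1 : ℝ) ≤ (P.H : ℝ) := by exact_mod_cast hH1'
  have hH : (0 : ℝ) < P.H := by linarith
  have hν := NWPi.log_lcmUpto_le P.H
  have harg := S.feld_arg_le P hI hx
  have h1 : (t : ℝ) * Real.log (Nat.lcmUpto P.H) ≤ t * (23 / 20 * (P.H : ℝ)) :=
    mul_le_mul_of_nonneg_left hν (by positivity)
  have h2 : Real.log (1 + (3 : ℝ) ^ (S.Istar3 P - I) * |(x₁ : ℝ)| / P.H) ≤
      Real.log (1 + (3 : ℝ) ^ (S.Istar3 P + k + 1) * P.X / P.H) := by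
    refine Real.log_le_log (by positivity) ?_
    have := div_le_div_of_nonneg_right harg hH.le
    linarith
  have h3 : (P.L₀ : ℝ) * (1 + Real.log (1 + (3 : ℝ) ^ (S.Istar3 P - I) * |(x₁ : ℝ)| / P.H)) ≤
      P.L₀ * (1 + Real.log (1 + (3 : ℝ) ^ (S.Istar3 P + k + 1) * P.X / P.H)) :=
    mul_le_mul_of_nonneg_left (by linarith) (by positivity)
  linarith

end TwoSetup

end Summit.ABC.StewartYu

end
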